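import Mathlib
import Summits.ResolutionOfSingularities.ResolutionOfSingularities.Theorems.RadicialJungCleanModelsCleanProp44TowerFace
import Summits.ResolutionOfSingularities.ResolutionOfSingularities.Theorems.RadicialJungCleanModelsCleanProp44LeafOrderTower
import HarnessLib

/-!
# Route `RadicialJung`, crux `CleanModels` (stmt-ResolutionOfSingularities-15917), line `Sketch` rev 35, stub 6 `stub_cleanProp44` (X44c):
# THE LEAF TOWER AND THE FACE FOR A FINITE TOWER — the relations of ✓ `leafSum_tower` / ✓ `leafOrder_tower` / ✓ `tower_face` / ✓ `tower_successor`
# required only BELOW the last level `d`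

Seat decomp-res-hand-2 g23 (structural hand).  The g20/g21 tower theorems quantify their relations (`ψ_j v_j = v_{j+1}` non-zero-divisors,
`ψ_j t_j = v_{j+1} t_{j+1}`, controlled transforms `v_{j+1}^μ f_{j+1} = ψ_j f_j`, `h_{j+1,e} = ψ_j h_{j,e}`) over ALL `j : ℕ`, although the inductions only
traverse the levels `j < d`; g21 already restricted the COCONE hypotheses to `j < d` (`cocone_apply_*_of_lt`), observing that an honest tower cannot be
extended beyond its top so as to satisfy everywhere-quantified hypotheses (the relation `ψ_j t_j = v_{j+1} t_{j+1}` has no solution `t_{j+1}` along an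
isomorphism `ψ_j`).  The chained σ-tower ✓ `sigmaTower` (hand-2 g23) delivers `hvnzd` exactly for `j < d`.  This file restates the four theorems with every
relation restricted to `j < d` (same proofs, bounded inductions), so that ✓ `sigmaTower` ∘ (this file) ∘ ✓ `birth_descent_of_exists_isLocalization`
composes on an honest finite tower:

* `leafSum_tower_of_lt`, `leafSum_tower_bottom_of_lt` — the element-level normal form after `j ≤ d` divisions and the `δ`-face modulo `v_d`.
* `leafOrder_tower_of_lt`, `leafOrder_tower_le_span_pair_pow_of_lt`, `leafOrder_tower_le_maximalIdeal_pow_of_lt` — the ideal side: the σ-curves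
  `Z_0, …, Z_{d−2}` are successively near.
* `tower_face_of_lt`, `tower_successor_of_lt` — the face `ε(f_d) = Φ` and the successor line `π = a(T + λ)`, `Φ = c(T + λ)^μ`, `deg λ ≤ d + 1`,
  `deg λ′ ≤ d − 1`.

Honest framing: OURS, bookkeeping only (bounded re-runs of landed inductions); nothing here proves X44c, any case of `CleanModels`, or resolution of
singularities in characteristic `p`. [cite: CossartPiltant2008, Lemma 4.3 (4)–(5); Prop. 4.4 (proof, p. 11)] [cite: CossartJannsenSaito2020, Lemma 7.5]
-/

noncomputable section

set_option linter.dupNamespace false -- mandated namespace of this single-conjunct summit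

open Polynomial

namespace Summit.ResolutionOfSingularities.ResolutionOfSingularities.Theorems.RadicialJung.CleanModels

/-! ## §1 The element-level tower below `d` -/

section LeafSum

variable (Aj : ℕ → Type*) [∀ j, CommRing (Aj j)] (ψ : ∀ j, Aj j →+* Aj (j + 1)) (μ d : ℕ)
  (t v f : ∀ j, Aj j) (h : ∀ j, ℕ → Aj j)

/-- ✓ `leafSum_tower` with the relations required only for `j < d`: after `j ≤ d` divisions `f_j = Σ_{e≤μ} t_j^e v_j^{(μ−e)(d−j)} h_{j,e}`.
[cite: CossartJannsenSaito2020, Lemma 7.5] [cite: CossartPiltant2008, Prop. 4.4 (proof, p. 11)] -/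
theorem leafSum_tower_of_lt (hv : ∀ j < d, ψ j (v j) = v (j + 1)) (hvnzd : ∀ j < d, v (j + 1) ∈ nonZeroDivisors (Aj (j + 1)))
    (ht : ∀ j < d, ψ j (t j) = v (j + 1) * t (j + 1)) (hf : ∀ j < d, v (j + 1) ^ μ * f (j + 1) = ψ j (f j))
    (hh : ∀ j < d, ∀ e, h (j + 1) e = ψ j (h j e))
    (h0 : f 0 = ∑ e ∈ Finset.range (μ + 1), t 0 ^ e * v 0 ^ ((μ - e) * d) * h 0 e) :
    ∀ j ≤ d, f j = ∑ e ∈ Finset.range (μ + 1), t j ^ e * v j ^ ((μ - e) * (d - j)) * h j e := by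
  intro j
  induction j with
  | zero => intro _; simpa using h0
  | succ j ih =>
    intro hj
    have hj' : j < d := by omega
    have hprev := ih (by omega)
    have hd1 : 1 ≤ d - j := by omega
    have key := eq_leafSum_of_pow_mul_eq (ψ j) μ (fun e => (μ - e) * (d - j))
      (fun e he => by
        have h1 : (μ - e) * 1 ≤ (μ - e) * (d - j) := Nat.mul_le_mul_left _ hd1
        rw [mul_one] at h1
        omega) (t := t j) (v := v j) (t' := t (j + 1))
      (by rw [hv j hj']; exact hvnzd j hj') (by rw [hv j hj']; exact ht j hj') (h j) (f' := f (j + 1))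
      (by rw [hv j hj', ← hprev]; exact hf j hj')
    rw [key]
    refine Finset.sum_congr rfl fun e he => ?_
    have he' : e ≤ μ := by simpa [Finset.mem_range, Nat.lt_succ_iff] using he
    rw [hv j hj', ← hh j hj', weight_step he' hd1, show d - j - 1 = d - (j + 1) from by omega]

/-- ✓ `leafSum_tower_bottom` with the relations required only for `j < d`: `f_d − Σ_{e≤μ} t_d^e g_e ∈ (v_d)` for any `g_e ≡ h_{d,e} (mod v_d)`.
[cite: CossartPiltant2008, Prop. 4.4 (proof, p. 11)] -/
theorem leafSum_tower_bottom_of_lt (hv : ∀ j < d, ψ j (v j) = v (j + 1)) (hvnzd : ∀ j < d, v (j + 1) ∈ nonZeroDivisors (Aj (j + 1)))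
    (ht : ∀ j < d, ψ j (t j) = v (j + 1) * t (j + 1)) (hf : ∀ j < d, v (j + 1) ^ μ * f (j + 1) = ψ j (f j))
    (hh : ∀ j < d, ∀ e, h (j + 1) e = ψ j (h j e))
    (h0 : f 0 = ∑ e ∈ Finset.range (μ + 1), t 0 ^ e * v 0 ^ ((μ - e) * d) * h 0 e)
    (g : ℕ → Aj d) (hg : ∀ e ≤ μ, h d e - g e ∈ Ideal.span {v d}) :
    f d - ∑ e ∈ Finset.range (μ + 1), t d ^ e * g e ∈ Ideal.span {v d} := by
  have h1 := leafSum_tower_of_lt Aj ψ μ d t v f h hv hvnzd ht hf hh h0 d le_rfl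
  have h2 : f d = ∑ e ∈ Finset.range (μ + 1), t d ^ e * v d ^ 0 * h d e := by
    rw [h1]
    refine Finset.sum_congr rfl fun e _ => by rw [Nat.sub_self, mul_zero]
  rw [h2]
  exact leafSum_sub_mem_of_weights_zero μ (h d) g hg

end LeafSum

/-! ## §2 The ideal-level tower below `d` -/

section LeafOrder

variable (Aj : ℕ → Type*) [∀ j, CommRing (Aj j)] (ψ : ∀ j, Aj j →+* Aj (j + 1)) (μ d : ℕ)
  (t v : ∀ j, Aj j) (J : ∀ j, Ideal (Aj j)) (𝔪₀ : Ideal (Aj 0))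

/-- ✓ `leafOrder_tower` with the relations required only for `j < d`: `J_j ⊆ Σ_{e≤μ} (t_j^e)·(v_j)^{(μ−e)(d−j)}` for `1 ≤ j ≤ d`.
[cite: CossartJannsenSaito2020, Lemma 7.5] [cite: CossartPiltant2008, Prop. 4.4 (proof, p. 11)] -/
theorem leafOrder_tower_of_lt (hv : ∀ j < d, ψ j (v j) = v (j + 1)) (hvnzd : ∀ j < d, v (j + 1) ∈ nonZeroDivisors (Aj (j + 1)))
    (ht : ∀ j < d, ψ j (t j) = v (j + 1) * t (j + 1)) (hJ : ∀ j < d, ∀ x ∈ J (j + 1), v (j + 1) ^ μ * x ∈ (J j).map (ψ j))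
    (h𝔪₀ : 1 ≤ d → 𝔪₀.map (ψ 0) ≤ Ideal.span {v 1})
    (h0 : J 0 ≤ ∑ e ∈ Finset.range (μ + 1), Ideal.span {t 0 ^ e} * 𝔪₀ ^ ((μ - e) * d)) :
    ∀ j, 1 ≤ j → j ≤ d → J j ≤ ∑ e ∈ Finset.range (μ + 1), Ideal.span {t j ^ e} * Ideal.span {v j} ^ ((μ - e) * (d - j)) := by
  intro j
  induction j with
  | zero => intro h; exact absurd h (by omega)
  | succ j ih =>
    intro _ hjd
    have hj' : j < d := by omega
    rcases Nat.eq_zero_or_pos j with rfl | hjpos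
    · intro x hx
      have h1 := mem_sum_of_pow_mul_mem_map_of_weight (ψ 0) 𝔪₀ (hvnzd 0 hj') (h𝔪₀ (by omega)) (ht 0 hj') μ d (by omega) h0 (hJ 0 hj' x hx)
      simpa using h1
    · have hprev := ih hjpos (by omega)
      have h𝔪 : (Ideal.span {v j}).map (ψ j) ≤ Ideal.span {v (j + 1)} := by
        rw [Ideal.map_span, Set.image_singleton, hv j hj']
      intro x hx
      have h1 := mem_sum_of_pow_mul_mem_map_of_weight (ψ j) (Ideal.span {v j}) (hvnzd j hj') h𝔪 (ht j hj') μ (d - j) (by omega)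
        hprev (hJ j hj' x hx)
      have h2 : d - j - 1 = d - (j + 1) := by omega
      rw [h2] at h1
      exact h1

/-- ✓ `leafOrder_tower_le_span_pair_pow` below `d`: for `1 ≤ j ≤ d − 1`, `J_j ⊆ (t_j, v_j)^μ` — the σ-curves `Z_0, …, Z_{d−2}` are successively near.
[cite: CossartPiltant2008, Lemma 4.3 (4)–(5); Prop. 4.4 (proof, p. 11)] -/
theorem leafOrder_tower_le_span_pair_pow_of_lt (hv : ∀ j < d, ψ j (v j) = v (j + 1))
    (hvnzd : ∀ j < d, v (j + 1) ∈ nonZeroDivisors (Aj (j + 1)))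
    (ht : ∀ j < d, ψ j (t j) = v (j + 1) * t (j + 1)) (hJ : ∀ j < d, ∀ x ∈ J (j + 1), v (j + 1) ^ μ * x ∈ (J j).map (ψ j))
    (h𝔪₀ : 1 ≤ d → 𝔪₀.map (ψ 0) ≤ Ideal.span {v 1})
    (h0 : J 0 ≤ ∑ e ∈ Finset.range (μ + 1), Ideal.span {t 0 ^ e} * 𝔪₀ ^ ((μ - e) * d))
    {j : ℕ} (hj1 : 1 ≤ j) (hjd : j + 1 ≤ d) :
    J j ≤ Ideal.span ({t j, v j} : Set (Aj j)) ^ μ := by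
  have h1 := leafOrder_tower_of_lt Aj ψ μ d t v J 𝔪₀ hv hvnzd ht hJ h𝔪₀ h0 j hj1 (by omega)
  refine le_span_pair_pow_of_le_sum (fun e => (μ - e) * (d - j)) (fun e he => ?_) h1
  have h2 : (μ - e) * 1 ≤ (μ - e) * (d - j) := Nat.mul_le_mul_left _ (by omega)
  rw [mul_one] at h2
  omega

/-- Pointwise form below `d`: at a point of `Z_{j−1}` (`t_j, v_j ∈ 𝔪`), `J_j ⊆ 𝔪^μ` for `1 ≤ j ≤ d − 1`. [cite: CossartPiltant2008, Lemma 4.3 (4)–(5)] -/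
theorem leafOrder_tower_le_maximalIdeal_pow_of_lt (hv : ∀ j < d, ψ j (v j) = v (j + 1))
    (hvnzd : ∀ j < d, v (j + 1) ∈ nonZeroDivisors (Aj (j + 1)))
    (ht : ∀ j < d, ψ j (t j) = v (j + 1) * t (j + 1)) (hJ : ∀ j < d, ∀ x ∈ J (j + 1), v (j + 1) ^ μ * x ∈ (J j).map (ψ j))
    (h𝔪₀ : 1 ≤ d → 𝔪₀.map (ψ 0) ≤ Ideal.span {v 1})
    (h0 : J 0 ≤ ∑ e ∈ Finset.range (μ + 1), Ideal.span {t 0 ^ e} * 𝔪₀ ^ ((μ - e) * d))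
    {j : ℕ} (hj1 : 1 ≤ j) (hjd : j + 1 ≤ d) [IsLocalRing (Aj j)]
    (htm : t j ∈ IsLocalRing.maximalIdeal (Aj j)) (hvm : v j ∈ IsLocalRing.maximalIdeal (Aj j)) :
    J j ≤ IsLocalRing.maximalIdeal (Aj j) ^ μ := by
  refine (leafOrder_tower_le_span_pair_pow_of_lt Aj ψ μ d t v J 𝔪₀ hv hvnzd ht hJ h𝔪₀ h0 hj1 hjd).trans (Ideal.pow_right_mono ?_ μ)
  rw [Ideal.span_le, Set.insert_subset_iff, Set.singleton_subset_iff]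
  exact ⟨htm, hvm⟩

end LeafOrder

/-! ## §3 The face and the successor for a finite tower -/

section TowerFace

variable {k : Type*} [Field k]
variable (Aj : ℕ → Type*) [∀ j, CommRing (Aj j)] (ψ : ∀ j, Aj j →+* Aj (j + 1)) (μ d : ℕ)
  (t v f : ∀ j, Aj j) (h : ∀ j, ℕ → Aj j)
variable {R : Type*} [CommRing R] {σι : Type*} (τ : R →+* Aj 0) (uf : σι → Aj 0) (G : ℕ → MvPolynomial σι R)
variable {S : Type*} [CommRing S] (ε₀ : Aj 0 →+* S) (ε : Aj d →+* S) (σ : R →+* k) (y : σι → k[X])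
variable [Fintype σι] [Algebra (k[X])[X] S]

/-- ✓ `tower_face` for a FINITE tower: the relations `hv hvnzd ht hf hh` are required only for `j < d`.  Conclusion verbatim: `ε(f_d) = Φ` with
`Φ = Σ_{e≤μ} T^e · Ḡ_e^σ(y)`, `deg_T Φ ≤ μ`, `Φ_μ = C(σ(G_μ(0)))`, `deg_u Φ_0 ≤ μ(d+1)`. [cite: CossartPiltant2008, Prop. 4.4 (proof, p. 11)]
[cite: CossartJannsenSaito2020, Lemma 7.5] -/
theorem tower_face_of_lt (hv : ∀ j < d, ψ j (v j) = v (j + 1)) (hvnzd : ∀ j < d, v (j + 1) ∈ nonZeroDivisors (Aj (j + 1)))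
    (ht : ∀ j < d, ψ j (t j) = v (j + 1) * t (j + 1)) (hf : ∀ j < d, v (j + 1) ^ μ * f (j + 1) = ψ j (f j))
    (hh : ∀ j < d, ∀ e, h (j + 1) e = ψ j (h j e))
    (h0 : f 0 = ∑ e ∈ Finset.range (μ + 1), t 0 ^ e * v 0 ^ ((μ - e) * d) * h 0 e)
    (hG : ∀ e, (G e).IsHomogeneous ((μ - e) * (d + 1)))
    (hh0 : ∀ e ≤ μ, h 0 e - MvPolynomial.eval₂ τ uf (G e) ∈ Ideal.span {v 0})
    (hθh : ∀ e ≤ μ, ε (h d e) = ε₀ (h 0 e)) (hθv : ε₀ (v 0) = 0)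
    (hεv : ε (v d) = 0) (hεt : ε (t d) = algebraMap (k[X])[X] S X)
    (hσ : ∀ r, ε₀ (τ r) = algebraMap (k[X])[X] S (C (C (σ r))))
    (hy : ∀ i, ε₀ (uf i) = algebraMap (k[X])[X] S (C (y i))) (hy1 : ∀ i, (y i).natDegree ≤ 1) :
    ε (f d) = algebraMap (k[X])[X] S
        (∑ e ∈ Finset.range (μ + 1), (X : (k[X])[X]) ^ e * C (MvPolynomial.eval₂ ((C : k →+* k[X]).comp σ) y (G e))) ∧
      (∑ e ∈ Finset.range (μ + 1), (X : (k[X])[X]) ^ e * C (MvPolynomial.eval₂ ((C : k →+* k[X]).comp σ) y (G e))).natDegree ≤ μ ∧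
      (∑ e ∈ Finset.range (μ + 1), (X : (k[X])[X]) ^ e * C (MvPolynomial.eval₂ ((C : k →+* k[X]).comp σ) y (G e))).coeff μ =
        C (σ (MvPolynomial.coeff 0 (G μ))) ∧
      ((∑ e ∈ Finset.range (μ + 1), (X : (k[X])[X]) ^ e * C (MvPolynomial.eval₂ ((C : k →+* k[X]).comp σ) y (G e))).coeff 0).natDegree ≤
        μ * (d + 1) := by
  have hbottom := leafSum_tower_bottom_of_lt Aj ψ μ d t v f h hv hvnzd ht hf hh h0 (h d) (fun e _ => by rw [sub_self]; exact zero_mem _)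
  have hcoef : ∀ e ≤ μ, ε (h d e) = algebraMap (k[X])[X] S (C (MvPolynomial.eval₂ ((C : k →+* k[X]).comp σ) y (G e))) := by
    intro e he
    have h1 : ε (h d e) = ε₀ (MvPolynomial.eval₂ τ uf (G e)) := by
      rw [hθh e he]
      obtain ⟨s, hs⟩ := Ideal.mem_span_singleton'.mp (hh0 e he)
      have h2 : ε₀ (h 0 e - MvPolynomial.eval₂ τ uf (G e)) = 0 := by rw [← hs, map_mul, hθv, mul_zero]
      rwa [map_sub, sub_eq_zero] at h2
    rw [h1, map_eval₂_eq_of_factor Aj τ uf ε₀ σ y ((algebraMap (k[X])[X] S).comp C) (fun r => by simp [hσ]) (fun i => by simp [hy])]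
    rfl
  refine ⟨map_eq_faceSum ε μ (h d) hbottom hεv hεt _ hcoef, natDegree_faceSum_le μ _, ?_, ?_⟩
  · rw [coeff_faceSum μ _ le_rfl, faceCoeff_of_isHomogeneous_zero σ y (by simpa using hG μ)]
  · rw [coeff_faceSum μ _ (Nat.zero_le _)]
    exact natDegree_faceCoeff_le _ (natDegree_C_comp_apply σ) y hy1 (by simpa using hG 0)

/-- ✓ `tower_successor` for a FINITE tower (relations only for `j < d`): with `σ(G_μ(0)) ≠ 0`, `1 ≤ μ`, `p ∣ d + 1` and a non-unit `π` with `π^μ ∣ Φ`: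
`π = a(T + λ)`, `Φ = c(T + λ)^μ`, `deg λ ≤ d + 1`, `deg λ′ ≤ d − 1`, `ε(f_d) = Φ`. [cite: CossartPiltant2008, Lemma 4.3 (5); Prop. 4.4 (proof, p. 11)] -/
theorem tower_successor_of_lt (hv : ∀ j < d, ψ j (v j) = v (j + 1)) (hvnzd : ∀ j < d, v (j + 1) ∈ nonZeroDivisors (Aj (j + 1)))
    (ht : ∀ j < d, ψ j (t j) = v (j + 1) * t (j + 1)) (hf : ∀ j < d, v (j + 1) ^ μ * f (j + 1) = ψ j (f j))
    (hh : ∀ j < d, ∀ e, h (j + 1) e = ψ j (h j e))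
    (h0 : f 0 = ∑ e ∈ Finset.range (μ + 1), t 0 ^ e * v 0 ^ ((μ - e) * d) * h 0 e)
    (hG : ∀ e, (G e).IsHomogeneous ((μ - e) * (d + 1)))
    (hh0 : ∀ e ≤ μ, h 0 e - MvPolynomial.eval₂ τ uf (G e) ∈ Ideal.span {v 0})
    (hθh : ∀ e ≤ μ, ε (h d e) = ε₀ (h 0 e)) (hθv : ε₀ (v 0) = 0)
    (hεv : ε (v d) = 0) (hεt : ε (t d) = algebraMap (k[X])[X] S X)
    (hσ : ∀ r, ε₀ (τ r) = algebraMap (k[X])[X] S (C (C (σ r))))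
    (hy : ∀ i, ε₀ (uf i) = algebraMap (k[X])[X] S (C (y i))) (hy1 : ∀ i, (y i).natDegree ≤ 1)
    (hμ : 1 ≤ μ) (hc : σ (MvPolynomial.coeff 0 (G μ)) ≠ 0) (hd : ((d + 1 : ℕ) : k) = 0)
    {π : (k[X])[X]} (hπ : ¬ IsUnit π)
    (hdvd : π ^ μ ∣ ∑ e ∈ Finset.range (μ + 1), (X : (k[X])[X]) ^ e * C (MvPolynomial.eval₂ ((C : k →+* k[X]).comp σ) y (G e))) :
    ∃ (a : k) (lam : k[X]), a ≠ 0 ∧ π = C (C a) * (X + C lam) ∧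
      (∑ e ∈ Finset.range (μ + 1), (X : (k[X])[X]) ^ e * C (MvPolynomial.eval₂ ((C : k →+* k[X]).comp σ) y (G e))) =
        C (C (σ (MvPolynomial.coeff 0 (G μ)))) * (X + C lam) ^ μ ∧
      lam.natDegree ≤ d + 1 ∧ (derivative lam).natDegree ≤ d + 1 - 2 ∧
      ε (f d) = algebraMap (k[X])[X] S (C (C (σ (MvPolynomial.coeff 0 (G μ)))) * (X + C lam) ^ μ) := by
  obtain ⟨hface, hdeg, htop, hC0⟩ :=
    tower_face_of_lt Aj ψ μ d t v f h τ uf G ε₀ ε σ y hv hvnzd ht hf hh h0 hG hh0 hθh hθv hεv hεt hσ hy hy1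
  obtain ⟨a, lam, ha, hπeq, hΦ, hlam, hlam'⟩ := exists_successor_of_solvableFace hμ hdeg hc htop hπ hdvd hC0 hd
  exact ⟨a, lam, ha, hπeq, hΦ, hlam, hlam', by rw [hface, hΦ]⟩

end TowerFace

end Summit.ResolutionOfSingularities.ResolutionOfSingularities.Theorems.RadicialJung.CleanModels

end
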